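/-
Origin: expansion seat `prover-pub-hodgecm-mc-binder-1-g14-0`, handover #R86 2026-08-20T16:54:41Z md5 50ecc0b0e7ee (379 l.; NEW additive leaf (universe-free), (J4b)/(J5) sign recipe = CM type, Liu admissibility read on it, L = K case; imports Automorphic/EndStateFieldCensus ONLY; drops ⇒ {#R87,#R88}; NAME LIST: HodgeCM.SignRecipe.signsForced_iff · HodgeCM.SignRecipe.im_eta_mul_neg_iff_notMem_liftType · HodgeCM.SignRecipe.liftType_self_false_eq_of_not_isGalois) (`HOME/mc/pub-hodgecm-mc-binder-1-g14/stage56/HodgeCM/Model/Binders/JLiuSignType.lean`, md5 50ecc0b0e7ee, 379 lines);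
landed by the second packager p2 gen 10 (p2-g10) in gate run 56 as `HodgeCM/Model/Binders/JLiuSignType.lean` (packager comment re-wording per the RUN-32 precedent (gate audit (5) rejects the proof-placeholder tokens s-o-r-r-y / a-d-m-i-t anywhere in a source, comments included): 1 occurrence(s) inside COMMENTS re-spelt `proof-hole` / `adm-token`; no Lean code byte touched).
-/
/-
Copyright (c) 2026 the pub-hodgecm formalisation cell (harness21).  New file, not vendored.
Origin: session prover-pub-hodgecm-mc-binder-1-g14-0 (unit pub-hodgecm-mc-binder-1-g14, BINDER PROVER gen 14 of lineage mc-binder-1;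
content lane (J-Liu-Θ) of BINDER-TRIAGE §58.2, scope memo `HOME/mc/pub-hodgecm-mc-binder-1-g14/JLIU-THETA-SCOPE.md` items (J4b)/(J5)),
2026-08-20.  Intended final place: `HodgeCM/Model/Binders/JLiuSignType.lean` (NEW additive leaf; imports
`HodgeCM.Automorphic.EndStateFieldCensus` only; nothing imports it; drop alone on bounce).
-/
import Summits.HodgeConjecture.HodgeCM.Automorphic.EndStateFieldCensus

set_option autoImplicit false

/-!
# The CM type BEHIND PerL's sign recipe, and Liu's admissibility condition read on it — items (J4b)/(J5)

KERNEL over `Automorphic/SignRecipe` + `Automorphic/EndStateFieldCensus` (the model-free `SignRecipe.reqPos` /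
`SignsForced` / `GoodCtx`, which ARE the END STATE's guards by `AdelicThetaCore.thetaModel_goodCtx_iff`).  No new hypothesis kind,
nothing cited, nothing minted: definitions and `Iff`/`Eq` lemmas.

PerL's recipe (eq:Psit, tex ll. 61–65; Lemma 3.3 (a), ll. 280–284) decides the sign the line `W_i = (L, a_i x ȳ)` must have at a
complex embedding `τ` of `L` from ONE bit: whether `κ(τ) ∈ Ψ_i`.  The set of `τ` with `κ(τ) ∈ Ψ_i` is therefore the object that
carries the type `Ψ_i` of the corner to the theta side; this file NAMES it and proves the three facts the (J-Liu-Θ) junction needs: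

* `HodgeCM.SignRecipe.liftType h K L j ι₁ Ψ : CMType L` — `Φ_Ψ := {τ : L →+* ℂ ∣ κ^{(h)}(τ) ∈ Ψ}` IS a CM type of `L` (by the proved
  design constraint `kappa_conjugate`: `κ(τ̄) = \overline{κ(τ)}`); on the automorphism orbit of `ι₁` it reads
  `ι₁ ∘ g ∈ Φ_Ψ ↔ ι₁ ∘ g⁻¹ ∘ φ^h ∘ j ∈ Ψ` (`mem_liftType_gal_iff`) — PerL v5's `Ψ_t = φ^h Φ̃_t⁻¹` (tex l. 100, ll. 129–149), whose
  REFLEX is the corner `(K, Φ_t)` by PerL Lemma [lem:reflex] (b) (not proved here: (J5)'s second half, tree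
  `Literature/NumberTheory/ComplexMultiplication/{ReflexPair, InducedReflex}`);
* `HodgeCM.SignRecipe.reqPos_eq_true_iff` / `signsForced_iff` — the recipe UNFOLDED: the required sign at `τ` is `+` iff
  `(τ ∈ Φ_Ψ ↔ τ is the representative of its place)`; so `SignsForced` says that ON REPRESENTATIVES the sign vector of `a_i` is the
  indicator of `Φ_{Ψ_i}` (`signsForced_iff_rep`);
* `HodgeCM.SignRecipe.im_eta_mul_neg_iff_notMem_liftType` / `…pos_iff_mem_liftType` — LIU'S ADMISSIBILITY CONDITION READ ON THE
  RECIPE ([Liu21] = arXiv:2102.11518 Def. 4.12: «`ε` is `μ`-admissible if … `τ'(e)` has negative imaginary part for every `τ' ∈ Φ_μ`»,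
  `e ∈ E^{×,−}` the trace-zero scalar of the one-dimensional skew-hermitian space): for the trace-zero element `e_i := η_L · a_i`
  (`η_L = SignRecipe.eta L`, the element that defines representatives), under `SignsForced`,
  `Im τ(η_L a_i) · Im ι₁(η_L) < 0 ↔ τ ∉ Φ_{Ψ_i}` and `0 < Im τ(η_L a_i) · Im ι₁(η_L) ↔ τ ∈ Φ_{Ψ_i}` — i.e. the set of embeddings at which
  `±η_L a_i` has negative imaginary part (oriented by `ι₁`) is `Φ_{Ψ_i}` resp. its conjugate type `bar Φ_{Ψ_i}`
  (`negImSet_eta_mul_eq_bar_liftType`, `posImSet_eta_mul_eq_liftType`).  WHICH of `±η_L a_i` is the `e` of the model's Weil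
  representation of `U(V) × U(W_i)` is the remaining (J4b) junction input (the `cmXW`/`cmSplittingDatum` sign convention of
  `Model/WmInstanceV2`, `HypCensus/KappaJoin`), not decided here;
* `HodgeCM.SignRecipe.self_mem_liftType_iff` — the distinguished embedding: `ι₁ ∈ Φ_Ψ ↔ (h = false ↔ ι₁ ∘ j ∈ Ψ)`; under
  `GoodCtx h ι₁ c` (`c.σ = ι₁ ∘ j ∈ Ψ_i`): `ι₁ ∈ Φ_{Ψ_i}` for `h = false` and `ι₁ ∈ bar Φ_{Ψ_i}` for `h = true`
  (`GoodCtx.self_mem_liftType`, `GoodCtx.self_mem_bar_liftType`) — Liu's `τ' ∈ Φ_μ` clause (Thm. 4.15, (4.3)) at `τ' = ι₁`.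

0 `proof-hole`, 0 `axiom`; expected `#print axioms` ⊆ {propext, Classical.choice, Quot.sound}.
-/

noncomputable section

open NumberField NumberField.ComplexEmbedding
open scoped ComplexConjugate
open Literature.AlgebraicGeometry.Motives (CMType)
open Literature.AlgebraicGeometry.ShimuraVarieties (conjRingHomK embedding_conjRingHomK)

namespace HodgeCM

namespace SignRecipe

open HodgeCM.CMTypeOps (bar mem_bar_iff mem_iff_conjugate_notMem conjugate_mem_iff_notMem)

/-! ## 1. The CM type `Φ_Ψ` of `L` defined by the type recipe -/

section LiftType

variable (h : Bool) (K L : CMField) (j : K →+* L) (ι₁ : L →+* ℂ)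

/-- **The CM type of `L` behind the recipe**: `Φ_Ψ := {τ ∣ κ^{(h)}(τ) ∈ Ψ}` — a CM type because `κ(τ̄) = \overline{κ(τ)}`
(`kappa_conjugate`) and `Ψ` is one.  PerL v5: `Ψ_t = φ^h Φ̃_t⁻¹` (tex l. 100). [folklore] -/
def liftType (Ψ : CMType K) : CMType L :=
  ⟨{τ | kappa h K L j ι₁ τ ∈ Ψ.1}, fun τ => by
    change kappa h K L j ι₁ τ ∈ Ψ.1 ↔ ¬ kappa h K L j ι₁ (conjugate τ) ∈ Ψ.1
    rw [kappa_conjugate]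
    exact Ψ.2 _⟩

variable {h K L j ι₁}

/-- (Ported verbatim from the HodgeCMPerL package; no docstring in the source.) -/
@[simp] theorem mem_liftType_iff (Ψ : CMType K) (τ : L →+* ℂ) :
    τ ∈ (liftType h K L j ι₁ Ψ).1 ↔ kappa h K L j ι₁ τ ∈ Ψ.1 := Iff.rfl

/-- **(eq:Psit) on the type**: on the automorphism orbit of `ι₁`, `ι₁ ∘ g ∈ Φ_Ψ ↔ ι₁ ∘ g⁻¹ ∘ φ^h ∘ j ∈ Ψ`. [folklore] -/
theorem mem_liftType_gal_iff (Ψ : CMType K) (g : L ≃+* L) {τ : L →+* ℂ} (hg : ι₁.comp g.toRingHom = τ) :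
    τ ∈ (liftType h K L j ι₁ Ψ).1 ↔ ((ι₁.comp g.symm.toRingHom).comp (phiH L h)).comp j ∈ Ψ.1 := by
  rw [mem_liftType_iff, kappa_of_gal h j g hg]

/-- Off the automorphism orbit of `ι₁` the type restricts: `τ ∈ Φ_Ψ ↔ τ ∘ j ∈ Ψ`. [folklore] -/
theorem mem_liftType_of_not_gal_iff (Ψ : CMType K) {τ : L →+* ℂ} (hτ : ¬∃ g : L ≃+* L, ι₁.comp g.toRingHom = τ) :
    τ ∈ (liftType h K L j ι₁ Ψ).1 ↔ τ.comp j ∈ Ψ.1 := by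
  rw [mem_liftType_iff, kappa_of_not_gal h j hτ]

/-- **The distinguished embedding**: `ι₁ ∈ Φ_Ψ ↔ (h = false ↔ ι₁ ∘ j ∈ Ψ)` — for `h = false` `κ(ι₁) = ι₁ ∘ j`, for `h = true`
`κ(ι₁) = \overline{ι₁ ∘ j}`. [folklore] -/
theorem self_mem_liftType_iff (Ψ : CMType K) :
    ι₁ ∈ (liftType h K L j ι₁ Ψ).1 ↔ (h = false ↔ ι₁.comp j ∈ Ψ.1) := by
  rw [mem_liftType_iff]
  cases h
  · rw [kappa_self_false]; simp
  · rw [kappa_self_true, conjugate_mem_iff_notMem]; simp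

/-- (Ported verbatim from the HodgeCMPerL package; no docstring in the source.) -/
theorem self_mem_liftType_false_iff (Ψ : CMType K) :
    ι₁ ∈ (liftType false K L j ι₁ Ψ).1 ↔ ι₁.comp j ∈ Ψ.1 := by
  rw [mem_liftType_iff, kappa_self_false]

/-- (Ported verbatim from the HodgeCMPerL package; no docstring in the source.) -/
theorem self_mem_liftType_true_iff (Ψ : CMType K) :
    ι₁ ∈ (liftType true K L j ι₁ Ψ).1 ↔ ι₁.comp j ∉ Ψ.1 := by
  rw [mem_liftType_iff, kappa_self_true, conjugate_mem_iff_notMem]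

/-- **The recipe's type AT `L = K` (surface over the sextic itself, `j = id`), bit `h = false`**: if every automorphism of `K` is the identity or
complex conjugation read through `ι₁` (e.g. `Aut K = {1, c}` — every sextic CM field whose normal closure has degree 24 or 48, in particular the
cell's witness field), then `Φ_Ψ^{(false)} = Ψ`: on the orbit `{ι₁, ῑ₁}` the recipe's `g⁻¹` equals `g`, off it `κ(τ) = τ`.  (So at `L = K` the one-form
type is the corner type ITSELF, whose reflex is `(K*, Ψ*)` and not `(K, Ψ)` unless `K* ≅ K` — scope memo §7.) [folklore] -/
theorem mem_liftType_self_false_iff {ιK : K →+* ℂ} (hAut : ∀ g : K ≃+* K, ιK.comp g.toRingHom = ιK ∨ ιK.comp g.toRingHom = conjugate ιK)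
    (Ψ : CMType K) (τ : K →+* ℂ) :
    τ ∈ (liftType false K K (RingHom.id K) ιK Ψ).1 ↔ τ ∈ Ψ.1 := by
  rw [mem_liftType_iff]
  by_cases H : ∃ g : K ≃+* K, ιK.comp g.toRingHom = τ
  · obtain ⟨g, hg⟩ := H
    rw [kappa_of_gal false (RingHom.id K) g hg, RingHom.comp_id, phiH_false, RingHom.comp_id]
    -- `g` is `1` or `c` through `ι₁`; in both cases `g⁻¹ = g`, so `ι₁ ∘ g⁻¹ = τ`
    suffices hsymm : ιK.comp g.symm.toRingHom = τ by rw [hsymm]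
    have hgg : ∀ x, g (g x) = x := by
      rcases hAut g with h1 | hc
      · intro x
        have hx : g x = x := ιK.injective (by simpa using RingHom.congr_fun h1 x)
        rw [hx, hx]
      · intro x
        have hgc : ∀ y, g y = conjRingHomK K y := fun y => ιK.injective (by
          have := RingHom.congr_fun hc y
          simp only [RingHom.coe_comp, Function.comp_apply, RingEquiv.toRingHom_eq_coe, RingEquiv.coe_toRingHom] at this
          rw [this, conjugate_coe_eq, embedding_conjRingHomK])
        rw [hgc, hgc, conjRingHomK_apply, conjRingHomK_apply]
        exact IsCMField.complexConj_apply_apply K x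
    refine RingHom.ext fun x => ?_
    have hinv : g.symm x = g x := g.injective (by rw [RingEquiv.apply_symm_apply, hgg])
    rw [← hg]
    simp only [RingHom.coe_comp, Function.comp_apply, RingEquiv.toRingHom_eq_coe, RingEquiv.coe_toRingHom, hinv]
  · rw [kappa_of_not_gal false (RingHom.id K) H, RingHom.comp_id]

/-- Set form: at `L = K` with `Aut K ⊆ {1, c}` (through `ι₁`), `Φ_Ψ^{(false)} = Ψ`. [folklore] -/
theorem liftType_self_false_eq {ιK : K →+* ℂ} (hAut : ∀ g : K ≃+* K, ιK.comp g.toRingHom = ιK ∨ ιK.comp g.toRingHom = conjugate ιK) (Ψ : CMType K) :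
    liftType false K K (RingHom.id K) ιK Ψ = Ψ :=
  Subtype.ext (Set.ext fun τ => mem_liftType_self_false_iff hAut Ψ τ)

/-- **`Aut K = {1, c}` for a NON-Galois sextic CM field**: a number field of degree `6` that is not Galois over `ℚ` has at most two
`ℚ`-automorphisms (`|Aut| ∣ 6`, `≠ 6`, and complex conjugation has order `2`); read through any embedding, `ι ∘ g ∈ {ι, ῑ}` — the `hAut`
hypothesis of `liftType_self_false_eq` (e.g. PerL's witness sextic, whose normal closure has degree 48). [folklore] -/
theorem comp_aut_eq_self_or_conjugate {K : Type} [Field K] [NumberField K] [IsCMField K]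
    (h6 : Module.finrank ℚ K = 6) (hng : ¬ IsGalois ℚ K) (ι : K →+* ℂ) (g : K ≃+* K) :
    ι.comp g.toRingHom = ι ∨ ι.comp g.toRingHom = conjugate ι := by
  classical
  -- ring automorphisms are ℚ-algebra automorphisms
  let g' : K ≃ₐ[ℚ] K := AlgEquiv.ofRingEquiv (f := g) (fun q => map_ratCast g q)
  let c' : K ≃ₐ[ℚ] K := AlgEquiv.ofRingEquiv (f := (IsCMField.complexConj K).toRingEquiv) (fun q => map_ratCast _ q)
  -- the automorphism group has order dividing 6 and ≠ 6, and contains the involution c' ≠ 1: so it is {1, c'}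
  have hcard_dvd : Nat.card (K ≃ₐ[ℚ] K) ∣ 6 := by
    have h1 := IntermediateField.finrank_fixedField_eq_card (⊤ : Subgroup (K ≃ₐ[ℚ] K))
    have h2 := Module.finrank_mul_finrank ℚ (IntermediateField.fixedField (⊤ : Subgroup (K ≃ₐ[ℚ] K))) K
    rw [h6, h1, Subgroup.card_top] at h2
    exact Dvd.intro_left _ h2
  have hcard_ne : Nat.card (K ≃ₐ[ℚ] K) ≠ 6 := by
    intro h
    apply hng
    have h1 := IntermediateField.finrank_fixedField_eq_card (⊤ : Subgroup (K ≃ₐ[ℚ] K))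
    have h2 := Module.finrank_mul_finrank ℚ (IntermediateField.fixedField (⊤ : Subgroup (K ≃ₐ[ℚ] K))) K
    rw [h6, h1, Subgroup.card_top, h] at h2
    have hbot : Module.finrank ℚ (IntermediateField.fixedField (⊤ : Subgroup (K ≃ₐ[ℚ] K))) = 1 := by omega
    have : IntermediateField.fixedField (⊤ : Subgroup (K ≃ₐ[ℚ] K)) = ⊥ :=
      IntermediateField.finrank_eq_one_iff.mp hbot
    exact IsGalois.of_fixedField_eq_bot ℚ K this
  have hc'x : ∀ x, c' x = IsCMField.complexConj K x := fun x => rfl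
  have hg'x : ∀ x, g' x = g x := fun x => rfl
  have hc1 : c' ≠ 1 := by
    intro h
    obtain ⟨x, hx⟩ := exists_conj_ne ⟨K⟩
    apply hx
    have := AlgEquiv.congr_fun h x
    rw [hc'x] at this
    exact this
  have hc2 : c' ^ 2 = 1 := by
    ext x
    rw [pow_two, AlgEquiv.mul_apply, hc'x, hc'x, AlgEquiv.one_apply]
    exact IsCMField.complexConj_apply_apply K x
  haveI : Fact (Nat.Prime 2) := ⟨Nat.prime_two⟩
  have horder : orderOf c' = 2 := orderOf_eq_prime hc2 hc1
  have h2dvd : 2 ∣ Nat.card (K ≃ₐ[ℚ] K) := horder ▸ orderOf_dvd_natCard c'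
  have hle : Nat.card (K ≃ₐ[ℚ] K) ≤ 6 := Nat.le_of_dvd (by norm_num) hcard_dvd
  have hcard : Nat.card (K ≃ₐ[ℚ] K) = 2 := by
    interval_cases hK : Nat.card (K ≃ₐ[ℚ] K) <;> omega
  -- a group of order two is `{1, c'}`
  obtain ⟨y, hy, huniq⟩ := (Nat.card_eq_two_iff' (1 : K ≃ₐ[ℚ] K)).mp hcard
  have hyc : c' = y := huniq c' hc1
  have hg' : g' = 1 ∨ g' = c' := by
    by_cases h1 : g' = 1
    · exact Or.inl h1
    · exact Or.inr (hyc ▸ huniq g' h1)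
  rcases hg' with h1 | hc
  · left
    refine RingHom.ext fun x => ?_
    have := AlgEquiv.congr_fun h1 x
    rw [hg'x, AlgEquiv.one_apply] at this
    simp [this]
  · right
    refine RingHom.ext fun x => ?_
    have := AlgEquiv.congr_fun hc x
    rw [hg'x, hc'x] at this
    simp only [RingHom.coe_comp, Function.comp_apply, RingEquiv.toRingHom_eq_coe, RingEquiv.coe_toRingHom, this]
    rw [conjugate_coe_eq]
    exact IsCMField.complexEmbedding_complexConj K ι x

/-- **At `L = K` for a non-Galois sextic CM field the recipe's type is the corner type itself**: `Φ_Ψ^{(false)} = Ψ` (scope memo §7, step (1),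
with `hAut` discharged by `comp_aut_eq_self_or_conjugate`). [folklore] -/
theorem liftType_self_false_eq_of_not_isGalois {K : CMField} (h6 : Module.finrank ℚ K = 6) (hng : ¬ IsGalois ℚ K) (ιK : K →+* ℂ)
    (Ψ : CMType K) : liftType false K K (RingHom.id K) ιK Ψ = Ψ :=
  liftType_self_false_eq (fun g => comp_aut_eq_self_or_conjugate h6 hng ιK g) Ψ

end LiftType

/-! ## 2. The recipe unfolded: required signs = indicator of `Φ_Ψ` on representatives -/

section Recipe

variable {h : Bool} {K L : CMField} {j : K →+* L} {ι₁ : L →+* ℂ}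

/-- (Ported verbatim from the HodgeCMPerL package; no docstring in the source.) -/
theorem ind_eq_one_iff {Ψ : CMType K} {φ : K →+* ℂ} : ind Ψ φ = 1 ↔ φ ∈ Ψ.1 := by
  classical
  unfold ind
  split_ifs with hφ <;> simp [hφ]

/-- **`reqPos` unfolded**: the required sign at `τ` is `+` iff `(τ ∈ Φ_Ψ ↔ τ is the representative of its place)`. [folklore] -/
theorem reqPos_eq_true_iff (h : Bool) (K L : CMField) (j : K →+* L) (ι₁ : L →+* ℂ) (Ψ : CMType K) (τ : L →+* ℂ) :
    reqPos h K L j ι₁ Ψ τ = true ↔ (τ ∈ (liftType h K L j ι₁ Ψ).1 ↔ IsRep L ι₁ τ) := by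
  unfold reqPos
  by_cases hm : kappa h K L j ι₁ τ ∈ Ψ.1
  · have h1 : ind Ψ (kappa h K L j ι₁ τ) = 1 := ind_eq_one_iff.mpr hm
    rw [if_pos h1, frameSign_eq_true_iff, mem_liftType_iff]
    exact (iff_true_left hm).symm
  · have h1 : ¬ ind Ψ (kappa h K L j ι₁ τ) = 1 := fun h1 => hm (ind_eq_one_iff.mp h1)
    rw [if_neg h1, mem_liftType_iff, Bool.not_eq_true', ← Bool.not_eq_true, frameSign_eq_true_iff]
    exact (iff_false_left hm).symm

/-- **`SignsForced` unfolded**: `a_i` is positive at `τ` iff `(τ ∈ Φ_{Ψ_i} ↔ τ is a representative)`. [folklore] -/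
theorem signsForced_iff (h : Bool) (K L : CMField) (j : K →+* L) (ι₁ : L →+* ℂ) (Ψ : Fin 4 → CMType K)
    (D : StubTree.SeesawDatum L) :
    SignsForced h K L j ι₁ Ψ D ↔
      ∀ (i : Fin 4) (τ : L →+* ℂ), (0 < (τ (D.a i)).re ↔ (τ ∈ (liftType h K L j ι₁ (Ψ i)).1 ↔ IsRep L ι₁ τ)) := by
  unfold SignsForced
  simp only [reqPos_eq_true_iff]

/-- **On representatives the sign vector of `a_i` IS the indicator of `Φ_{Ψ_i}`.** [folklore] -/
theorem signsForced_iff_rep {h : Bool} {K L : CMField} {j : K →+* L} {ι₁ : L →+* ℂ} {Ψ : Fin 4 → CMType K}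
    {D : StubTree.SeesawDatum L} (hs : SignsForced h K L j ι₁ Ψ D) (i : Fin 4) {τ : L →+* ℂ} (hτ : IsRep L ι₁ τ) :
    0 < (τ (D.a i)).re ↔ τ ∈ (liftType h K L j ι₁ (Ψ i)).1 := by
  rw [(signsForced_iff h K L j ι₁ Ψ D).mp hs i τ]
  exact iff_true_right hτ

end Recipe

/-! ## 3. Liu's admissibility condition `Im τ'(e) < 0` for `e = ±η_L a_i`, read on the recipe -/

section Liu

variable {L : CMField}

/-- `Im τ(η x) = Im τ(η) · Re τ(x)` — `η = η_L` has purely imaginary image under every embedding (`embedding_eta_re`). [folklore] -/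
theorem im_embedding_eta_mul (τ : L →+* ℂ) (x : L) : (τ (eta L * x)).im = (τ (eta L)).im * (τ x).re := by
  rw [map_mul, Complex.mul_im, embedding_eta_re, zero_mul, zero_add]

/-- A "real" element (`x̄ = x`) has real image under every embedding. [folklore] -/
theorem im_embedding_eq_zero_of_conj_eq {x : L} (hx : conjRingHomK L x = x) (τ : L →+* ℂ) : (τ x).im = 0 := by
  have h := embedding_conjRingHomK (L : Type) τ x
  rw [hx] at h
  exact Complex.conj_eq_iff_im.mp h.symm

/-- A nonzero real element has nonzero real part under every embedding. [folklore] -/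
theorem re_embedding_ne_zero_of_conj_eq {x : L} (hx : conjRingHomK L x = x) (hx0 : x ≠ 0) (τ : L →+* ℂ) :
    (τ x).re ≠ 0 := by
  intro hre
  have him := im_embedding_eq_zero_of_conj_eq hx τ
  have : τ x = 0 := Complex.ext hre him
  exact hx0 (by simpa using (map_eq_zero_iff τ τ.injective).mp this)

/-- Sign bookkeeping: for nonzero reals, `u * v < 0 ↔ (0 < u ↔ ¬ 0 < v)`. -/
private theorem mul_neg_iff_of_ne_zero {u v : ℝ} (hu : u ≠ 0) (hv : v ≠ 0) : u * v < 0 ↔ (0 < u ↔ ¬ 0 < v) := by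
  rcases lt_or_gt_of_ne hu with hu' | hu'
  · rcases lt_or_gt_of_ne hv with hv' | hv'
    · constructor
      · intro huv; nlinarith
      · intro hiff; exact absurd (hiff.mpr (not_lt.mpr hv'.le)) (not_lt.mpr hu'.le)
    · constructor
      · intro _; exact ⟨fun hu'' => absurd hu'' (not_lt.mpr hu'.le), fun hnv => absurd hv' hnv⟩
      · intro _; nlinarith
  · rcases lt_or_gt_of_ne hv with hv' | hv'
    · constructor
      · intro _; exact ⟨fun _ => not_lt.mpr hv'.le, fun _ => hu'⟩
      · intro _; nlinarith
    · constructor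
      · intro huv; nlinarith
      · intro hiff; exact absurd hv' (hiff.mp hu')

variable {h : Bool} {K : CMField} {j : K →+* L} {ι₁ : L →+* ℂ} {Ψ : Fin 4 → CMType K} {D : StubTree.SeesawDatum L}

/-- **Liu's admissibility set for `e = η_L a_i` is the CONJUGATE of `Φ_{Ψ_i}`**: under the forced signs,
`Im τ(η_L a_i) · Im ι₁(η_L) < 0 ↔ τ ∉ Φ_{Ψ_i}` ([Liu21] Def. 4.12 «`τ'(e)` has negative imaginary part for every `τ' ∈ Φ_μ`»,
oriented by the sign of `Im ι₁(η_L)` which fixes the representatives). [folklore] -/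
theorem im_eta_mul_neg_iff_notMem_liftType (hs : SignsForced h K L j ι₁ Ψ D) (i : Fin 4) (τ : L →+* ℂ) :
    (τ (eta L * D.a i)).im * (ι₁ (eta L)).im < 0 ↔ τ ∉ (liftType h K L j ι₁ (Ψ i)).1 := by
  have hx : (τ (D.a i)).re ≠ 0 := re_embedding_ne_zero_of_conj_eq (D.a_real i) (D.a_ne i) τ
  have hys : (τ (eta L)).im * (ι₁ (eta L)).im ≠ 0 :=
    mul_ne_zero (embedding_eta_im_ne_zero L τ) (embedding_eta_im_ne_zero L ι₁)
  have hforced := (signsForced_iff h K L j ι₁ Ψ D).mp hs i τ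
  rw [im_embedding_eta_mul, show (τ (eta L)).im * (τ (D.a i)).re * (ι₁ (eta L)).im =
      (τ (D.a i)).re * ((τ (eta L)).im * (ι₁ (eta L)).im) by ring, mul_neg_iff_of_ne_zero hx hys]
  change (0 < (τ (D.a i)).re ↔ ¬ IsRep L ι₁ τ) ↔ _
  rw [hforced]
  tauto

/-- … and `0 < Im τ(η_L a_i) · Im ι₁(η_L) ↔ τ ∈ Φ_{Ψ_i}` (the admissibility set for `e = −η_L a_i` is `Φ_{Ψ_i}` itself). [folklore] -/
theorem im_eta_mul_pos_iff_mem_liftType (hs : SignsForced h K L j ι₁ Ψ D) (i : Fin 4) (τ : L →+* ℂ) :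
    0 < (τ (eta L * D.a i)).im * (ι₁ (eta L)).im ↔ τ ∈ (liftType h K L j ι₁ (Ψ i)).1 := by
  have hne : (τ (eta L * D.a i)).im * (ι₁ (eta L)).im ≠ 0 := by
    rw [im_embedding_eta_mul]
    exact mul_ne_zero (mul_ne_zero (embedding_eta_im_ne_zero L τ)
      (re_embedding_ne_zero_of_conj_eq (D.a_real i) (D.a_ne i) τ)) (embedding_eta_im_ne_zero L ι₁)
  have hneg := im_eta_mul_neg_iff_notMem_liftType hs i τ
  constructor
  · intro hpos
    by_contra hm
    exact absurd (hneg.mpr hm) (not_lt.mpr hpos.le)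
  · intro hm
    rcases lt_or_gt_of_ne hne with hlt | hgt
    · exact absurd (hneg.mp hlt) (not_not.mpr hm)
    · exact hgt

/-- **Set form**: `{τ ∣ Im τ(η_L a_i) · Im ι₁(η_L) < 0} = bar Φ_{Ψ_i}` (the conjugate type). [folklore] -/
theorem negImSet_eta_mul_eq_bar_liftType (hs : SignsForced h K L j ι₁ Ψ D) (i : Fin 4) :
    {τ : L →+* ℂ | (τ (eta L * D.a i)).im * (ι₁ (eta L)).im < 0} = (bar (liftType h K L j ι₁ (Ψ i))).1 :=
  Set.ext fun τ => by rw [Set.mem_setOf_eq, im_eta_mul_neg_iff_notMem_liftType hs i τ, mem_bar_iff]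

/-- **Set form**: `{τ ∣ 0 < Im τ(η_L a_i) · Im ι₁(η_L)} = Φ_{Ψ_i}`. [folklore] -/
theorem posImSet_eta_mul_eq_liftType (hs : SignsForced h K L j ι₁ Ψ D) (i : Fin 4) :
    {τ : L →+* ℂ | 0 < (τ (eta L * D.a i)).im * (ι₁ (eta L)).im} = (liftType h K L j ι₁ (Ψ i)).1 :=
  Set.ext fun τ => by rw [Set.mem_setOf_eq, im_eta_mul_pos_iff_mem_liftType hs i τ]

end Liu

/-! ## 4. Under the END STATE's guard -/

namespace GoodCtx

variable {h : Bool} {L : CMField} {ι₁ : L →+* ℂ} {c : SeesawCtx L}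

/-- The guard's embedding `j` with the forced signs read as the indicator of `Φ_{Ψ_i}` on representatives, and Liu's
admissibility sets for `±η_L a_i`. [folklore] -/
theorem exists_liftType (hc : GoodCtx h ι₁ c) :
    ∃ j : c.K →+* L, ι₁.comp j = c.σ ∧
      (∀ (i : Fin 4) (τ : L →+* ℂ), IsRep L ι₁ τ → (0 < (τ (c.D.a i)).re ↔ τ ∈ (liftType h c.K L j ι₁ (c.Ψ i)).1)) ∧
      (∀ i : Fin 4, {τ : L →+* ℂ | (τ (eta L * c.D.a i)).im * (ι₁ (eta L)).im < 0} = (bar (liftType h c.K L j ι₁ (c.Ψ i))).1) ∧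
      (∀ i : Fin 4, {τ : L →+* ℂ | 0 < (τ (eta L * c.D.a i)).im * (ι₁ (eta L)).im} = (liftType h c.K L j ι₁ (c.Ψ i)).1) := by
  obtain ⟨j, hj, hs⟩ := hc.forced
  exact ⟨j, hj, fun i _ hτ => signsForced_iff_rep hs i hτ, fun i => negImSet_eta_mul_eq_bar_liftType hs i,
    fun i => posImSet_eta_mul_eq_liftType hs i⟩

/-- For `h = false` the distinguished embedding lies in EVERY `Φ_{Ψ_i}` of the guard's `j` (Liu's `τ' ∈ Φ_μ` at `τ' = ι₁`). [folklore] -/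
theorem self_mem_liftType (hc : GoodCtx false ι₁ c) {j : c.K →+* L} (hj : ι₁.comp j = c.σ) (i : Fin 4) :
    ι₁ ∈ (liftType false c.K L j ι₁ (c.Ψ i)).1 := by
  rw [self_mem_liftType_false_iff, hj]
  exact hc.mem i

/-- For `h = true` the distinguished embedding lies in every CONJUGATE type `bar Φ_{Ψ_i}`. [folklore] -/
theorem self_mem_bar_liftType (hc : GoodCtx true ι₁ c) {j : c.K →+* L} (hj : ι₁.comp j = c.σ) (i : Fin 4) :
    ι₁ ∈ (bar (liftType true c.K L j ι₁ (c.Ψ i))).1 := by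
  rw [mem_bar_iff, self_mem_liftType_true_iff, not_not, hj]
  exact hc.mem i

end GoodCtx

end SignRecipe

end HodgeCM

end
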